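import Literature.Geometry.Lorentzian.KlainermanSzeftel2021.SupToFluxExponents

/-!
# Klainerman–Szeftel Lemma 9.4.13, the `B`-terms of `ℜ_{k_small−1}`: the exponent count of the FRAME-TRANSFER route
(Step 18 of the proof of Theorem M7 re-run on the weight of [J] Prop 6.5.4)

CITATION HEADER (lean-in-tree rule 2026-08-18).  This module is EXPONENT BOOKKEEPING (elementary real arithmetic,
kernel-proved, tagged `[folklore]` where no display is quoted) about displays PRINTED in

* S. Klainerman, J. Szeftel, *Kerr stability for small angular momentum*, arXiv:2104.11857 (v1, 2021; TeX source
  `Main-Kerr-arxiv.tex`, line numbers `KS l.N`) = bib key `KlainermanSzeftel2021`; refereed text Pure Appl. Math. Q. **19**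
  (2023) no. 3 = bib key `KlainermanSzeftel2023`, read in the authors' accepted manuscript HAL hal-04280491 (pages `[J] p.N` =
  PDF page of that file, arXiv-style numbering).  The two texts agree at every locus used here EXCEPT that the two-branch
  bound for `B` of `[J]` Prop 6.5.4 (`[J]` p.407: `|𝔡^{≤k_*−6}B| ≲ ε₀ min{r^{−7/2−δ_dec}, r^{−3−δ'}u^{−1/2−δ_dec}}` on `ᵉˣᵗ𝓜`,
  `k_* = k_small + 60`) has only its second branch in v1 (KS l.16632–16640).

KS is a refereed publication under adjudication in the audit cell `pub-kerr` (Final State Conjecture programme, near-miss cell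
6); its displays enter here as PARAMETERS, never as cited facts; nothing in this file is progress on the Final State Conjecture
or on Kerr stability.  The module asserts nothing about the papers' analysis: it certifies the arithmetic of the audit cell's
GAPS.md Block 41 (seat b2b-kerr-adep1 gen 15, 2026-08-19), companion to `…KlainermanSzeftel2021.SupToFluxExponents`
(imported; used: `margin`, `wAB`, `wABstar`, `rateA_M1`, `deltaPrime`, `marginA_M1`, `marginB_rate4`,
`radial_bounded_of_margin_pos`), `…MixedRateCount` and `…OutgoingTransportCount` (not imported).

THE PRINTED SENTENCES BEING RE-RUN.  (i) Step 18 of the proof of Theorem M7 (KS l.22961–23053 = [J] §8.5 p.589–591,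
(8.5.63)–(8.5.68)): with `(e₄,e₃,e₁,e₂)` "the outgoing PG frame of `ᵉˣᵗ𝓜` extended to the spacetime `𝓜^{(extend)}`" and
`(ẽ_μ)` the outgoing PG frame of the extension `𝓜̃` initialised on the new last slice `Σ̃_*`, the transition coefficients obey
(8.5.65) `sup_{ᵉˣᵗ𝓜̃} (r̃ũ^{½+δ_dec} + ũ^{1+δ_dec})(|𝔡^k(f, log λ)| + |𝔡^{k−1}f̲|) ≲ ε₀`, `k ≤ k_*−9`, `k_* = k_small+20` (KS l.22994–23000),
the old structure obeys (8.5.64) `𝔑^{(Dec)}_{k_*−3}(𝓜^{(extend)}) ≲ ε₀` (l.22975–22980), and "using the transformation formulas of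
Proposition 2.2.3 … we deduce `𝔑^{(Dec)}_{k_*−12}(𝓜̃) ≲ ε₀`" (l.23045–23047).  (ii) Proposition 2.2.3 = [J] (2.2.21) (KS l.2417–2422,
identical in [J] p.65): `λ^{−1}β' = β + (3/2)(fρ + *f *ρ) + ½α·f̲ + l.o.t.`, `l.o.t. = O((f,f̲)³)(ρ,*ρ) + O((f,f̲)²)(α,β,α̲,β̲)`,
"containing no derivatives" (l.2443–2449).  (iii) Lemma 9.4.13 items 1, 2, 6 (KS l.24374–24425 = [J] (9.4.26)–(9.4.33)): on `ᵉˣᵗ𝓜̃`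
the PG → PT change has `f = 0`, `λ = 1`, `sup_{ᵉˣᵗ𝓜} ru^{½+δ_dec}|𝔡^{≤k_small}f̲| ≲ ε₀` (l.24377–24399), and item 6 transfers the
PG sup bounds to the PT frame "by the change of frame formulas of Proposition 2.2.3".  (iv) [J] Prop 5.7.3 (p.319) = KS Prop.
l.12782–12790: `sup_{Σ_*} r^{7/2+δ_extra}|𝔡^k B'| ≲ ε₀`, `k ≤ k_small+65`.  (v) `δ_ext` "can be chosen arbitrarily small" (KS l.22954 =
[J] p.589), `Δ_ext = d₀r_*δ_ext/u_*` (l.21644–21652).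

THE COUNT (audit reading, as in `SupToFluxExponents`: on `ᵉˣᵗ𝓜` the `B`-term of `ᵉˣᵗℜ²_k` has integrand `r^{5+δ_B}|𝔡^{≤k}B|²`
in `dr du`, KS l.23911–23916 = [J] (9.4.4)).  Re-running (i)–(iii) on the weight `r^{7/2+δ_dec}` instead of the `𝔇`-weights gives
on `ᵉˣᵗ𝓜̃ ∩ ᵉˣᵗ𝓜`, for `k ≤ k_small+7`, the [J] two-branch profile for `𝔡̃^{≤k}B̃` plus ERROR MONOMIALS `ε₀^p r^{−a}u^{−b}`:
`(3/2)Fρ` (far `ε₀ m r^{−4}u^{−½−δ_dec}`, near `r ≤ √u`: `ε₀ m r^{−3}u^{−1−δ_dec}`), `½A·F̲` (far `ε₀²r^{−7/2−δ_extra}u^{−1−δ_dec}`,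
near `r ≤ u`: `ε₀²r^{−3}u^{−3/2−δ_dec−δ_extra}`), `O(f²)B̲`, `O(f³)A̲`, the PT-passage term `f̲_PT·A`, and the layer FTC term
`ε₀Δ_ext r^{−4}u^{−½−δ_dec}` (§2 below).  A far monomial is harmless iff its margin `2a − (6+δ_B)` is positive (then it is
`r_*`-free) and its `u`-exponent after the radial integration from `r = u^x`, `x(6+δ_B−2a) − 2b`, is `< −1`; a near one iff
`x·max(6+δ_B−2a, 0) − 2b < −1`.  §2 proves all of these UNCONDITIONALLY in the admissible range (`0 < δ_dec`, `δ_dec < δ_extra`,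
`0 < δ_B < 1`).  What is NOT unconditional is only the main profile's own count — the window `2δ_dec < δ_B < T`,
`T := 2δ_dec + (δ_extra − δ_dec)/(1+2δ_dec)` of the lead's variant V-J654 (GAPS block 36 (2)); §3 re-derives `T` and proves
`T < 2δ_extra`.  §4: the `Σ̃_*`-piece `∫_{Σ_*} r^{4+δ_B}|B|²` with the far branch carries `ε₀^{3−δ_B+2δ_dec}` and the `u_*`-power
`δ_B(1+δ_dec) − δ_dec(3+2δ_dec)`, NEGATIVE on the whole window when `δ_extra ≤ 3δ_dec/2` (GKS's `δ_extra = (3δ_dec−2δ)/2`).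
§5: the top piece — `ᵗᵒᵖℜ²_k ∋ ∫_{𝓜top(r ≥ r₀)} r^{3+δ_B}|𝔡^{≤k}(A,B)|²` (KS l.23988–23997) — is harmless from RATE-3 information
alone because `ᵗᵒᵖ𝓜(r ≥ r₀)` is thin with an `r`-decaying width: with the PRINTED `σ_top(r) = −2(r−r₀) − 4m log(r/r₀) − m²/r + c₂`
(KS §3 footnote l.5377–5384 = App. D `f₂`, l.32055–32061) and `ᵗᵒᵖu := u̲ − 2∫_{r₀}^r (r'²+a²)/Δ` (l.5965–5969), the `ᵗᵒᵖu`-width at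
radius `r` is `w(r) = ∫_r^{r_*} g'` with `g'(r) r²Δ = 9m²r² − (4ma²+2m³)r + m²a²` (`widthNumerator`, positive for `r ≥ m ≥ |a|`),
`g' = 9m²/r² + O(m³/r³)`, so the top `B`-integrand from rate 3 is `≍ m² r^{−2+δ_B}` — margin `1 − δ_B > 0`; an `r`-INDEPENDENT width
(all that Prop 9.3.5 item 3, l.23785–23788, states) would give `r^{−1+δ_B}`, margin `−δ_B`, the `ε₀^{−δ_B}` loss of block 9 (3)(c2).

STATUS.  CENSUS OBSERVATION of the audit cell (GAPS.md Block 41), typed as arithmetic.  It does not assert that Lemma 9.4.13 is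
proved as printed: the constants window of §3 (`2δ_dec < δ_B < T`; KS l.6076–6081 print only `δ_B > 2δ_dec`) stays an unprinted
input, and the transfer sentences (i)–(iii) are printed for the `𝔇`-weights, not for the weight `r^{7/2+δ_dec}`.  Two independent
numeric engines of the cell (`code/adep1-g15/`, sympy / fractions+mpmath) agree with every statement below.
-/

open Real Set MeasureTheory intervalIntegral

noncomputable section

namespace Literature.Geometry.Lorentzian.KlainermanSzeftel2021.FrameTransferCount

open SupToFluxExponents

/-! ## §1 Far/near bookkeeping of an error monomial `ε₀^p r^{-a} u^{-b}` against the weight `r^{3+δ_B}` -/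

/-- Far-zone margin of a rate-`a` monomial in the `B`-term of `ᵉˣᵗℜ²`: `2a − (6+δ_B)` (= `margin (wAB δB) a`).  [folklore] -/
theorem farMargin_eq (δB a : ℝ) : margin (wAB δB) a = 2 * a - (6 + δB) := by
  unfold margin wAB; ring

/-- `u`-exponent left after the radial integration of `r^{5+δ_B−2a}u^{−2b}` over a zone ending (far: starting) at `r = u^x`:
`x(6+δ_B−2a) − 2b`; the `u`-integral `∫₁^{u_*}` is `u_*`-uniform iff this is `< −1`.  [folklore] -/
def uExp (x δB a b : ℝ) : ℝ := x * (6 + δB - 2 * a) - 2 * b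

/-! ## §2 The error monomials of the transfer (GAPS Block 41 table (3)) — all unconditional -/

/-- `(3/2)Fρ`, far zone `r ≥ √u`: `|f| ≲ ε₀ r^{−1}u^{−½−δ_dec}` ((8.5.65)) times `|ρ| ≲ m r^{−3}`: rate `4`, margin `2 − δ_B`
(`SupToFluxExponents.marginB_rate4`), positive for `δ_B < 2`.
[cite: KlainermanSzeftel2021, (8.5.65) TeX l.22994–23000 with Prop 2.2.3 l.2417–2422] -/
theorem frho_far_margin_pos {δB : ℝ} (hB : δB < 2) : 0 < margin (wAB δB) 4 := by rw [marginB_rate4]; linarith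

/-- … and its `u`-exponent from `r = u^{1/2}`: `(δ_B − 2)/2 − 1 − 2δ_dec < −1`.
[cite: KlainermanSzeftel2021, (8.5.65) TeX l.22994–23000] -/
theorem frho_far_u {δB δdec : ℝ} (hB : δB < 2) (hd : 0 ≤ δdec) :
    uExp (1 / 2) δB 4 (1 / 2 + δdec) < -1 := by
  unfold uExp; nlinarith

/-- `(3/2)Fρ`, near zone `r ≤ √u`: `|f| ≲ ε₀u^{−1−δ_dec}` times `m r^{−3}`: rate `3` (below critical) but cut at `r = √u`:
`u`-exponent `δ_B/2 − 2 − 2δ_dec < −1`.  [cite: KlainermanSzeftel2021, (8.5.65) TeX l.22994–23000] -/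
theorem frho_near_u {δB δdec : ℝ} (hB : δB < 2) (hd : 0 ≤ δdec) :
    uExp (1 / 2) δB 3 (1 + δdec) < -1 := by
  unfold uExp; nlinarith

/-- `½A·F̲`, far zone `r ≥ u`: `|F̲| ≲ ε₀u^{−1−δ_dec}` ((8.5.65), one fewer derivative) times Theorem M1's far rate for `A`
(Ref 2, l.13745–13757): rate `7/2 + δ_extra`, margin `1 + 2δ_extra − δ_B` = `SupToFluxExponents.marginA_M1` (positive:
`marginA_M1_pos`); its `u`-exponent from `r = u` is `δ_B − 3 − 2δ_dec − 2δ_extra < −1`.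
[cite: KlainermanSzeftel2021, Ref 2 TeX l.13745–13757; Prop 2.2.3 l.2417–2422; (8.5.65) l.22994–23000] -/
theorem afb_far_u {δB δdec δextra : ℝ} (hB : δB < 1) (hd : 0 ≤ δdec) (he : 0 ≤ δextra) :
    uExp 1 δB (rateA_M1 δextra) (1 + δdec) < -1 := by
  unfold uExp rateA_M1; nlinarith

/-- `½A·F̲`, near zone `r ≤ u`: `A`'s near rate `3` with `u^{−½−δ_extra}`, times `ε₀u^{−1−δ_dec}`: `u`-exponent
`δ_B − 3 − 2δ_dec − 2δ_extra < −1`.  [cite: KlainermanSzeftel2021, Ref 2 TeX l.13745–13757] -/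
theorem afb_near_u {δB δdec δextra : ℝ} (hB : δB < 2) (hd : 0 ≤ δdec) (he : 0 ≤ δextra) :
    uExp 1 δB 3 (3 / 2 + δdec + δextra) < -1 := by
  unfold uExp; nlinarith

/-- `O(f²)B̲`: far `ε₀³r^{−4}u^{−2−3δ_dec}` (`|B̲| ≲ ε₀r^{−2}u^{−1−δ_dec}` from (8.5.64), `rB̲ ∈ Γ_b`), near (`r ≤ √u`) rate `2`.
[cite: KlainermanSzeftel2021, (8.5.64) TeX l.22975–22980; Prop 2.2.3 l.2443–2449] -/
theorem f2bb_far_u {δB δdec : ℝ} (hB : δB < 2) (hd : 0 ≤ δdec) :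
    0 < margin (wAB δB) 4 ∧ uExp (1 / 2) δB 4 (2 + 3 * δdec) < -1 := by
  refine ⟨frho_far_margin_pos hB, ?_⟩; unfold uExp; nlinarith

/-- `O(f²)B̲`, near zone `r ≤ √u` (rate `2`, `|f|² ≲ ε₀²u^{−2−2δ_dec}`): `u`-exponent `(2+δ_B)/2 − 6 − 6δ_dec < −1`.  [cite: KlainermanSzeftel2021, (8.5.64)/(8.5.65) TeX l.22975–23000] -/
theorem f2bb_near_u {δB δdec : ℝ} (hB : δB < 2) (hd : 0 ≤ δdec) :
    uExp (1 / 2) δB 2 (3 + 3 * δdec) < -1 := by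
  unfold uExp; nlinarith

/-- `O(f³)A̲` — the LOWEST power of `f` with which `A̲ = R(e_b,e₃,e_c,e₃)` can enter `R(e'_a,e'₄,e'₃,e'₄)` under
`e'₄ = λ(e₄ + f^b e_b + ¼|f|²e₃)` (both `e'₄`-slots must leave `e₄`, one `e₃` must come from `e'_a` or `e'₄`): far
`ε₀⁴r^{−4}u^{−5/2−4δ_dec}`, near (`r ≤ √u`) rate `1` with `u^{−4−4δ_dec}`.
[cite: KlainermanSzeftel2021, Lemma 2.2.1 TeX l.2177–2187; Prop 2.2.3 l.2443–2449; (8.5.64)] -/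
theorem f3ab_far_u {δB δdec : ℝ} (hB : δB < 2) (hd : 0 ≤ δdec) :
    0 < margin (wAB δB) 4 ∧ uExp (1 / 2) δB 4 (5 / 2 + 4 * δdec) < -1 := by
  refine ⟨frho_far_margin_pos hB, ?_⟩; unfold uExp; nlinarith

/-- `O(f³)A̲`, near zone `r ≤ √u` (rate `1`, `|f|³ ≲ ε₀³u^{−3−3δ_dec}`): `u`-exponent `(4+δ_B)/2 − 8 − 8δ_dec < −1`.  [cite: KlainermanSzeftel2021, (8.5.64)/(8.5.65) TeX l.22975–23000] -/
theorem f3ab_near_u {δB δdec : ℝ} (hB : δB < 2) (hd : 0 ≤ δdec) :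
    uExp (1 / 2) δB 1 (4 + 4 * δdec) < -1 := by
  unfold uExp; nlinarith

/-- PG(𝓜̃) → PT(𝓜̃) on `ᵉˣᵗ𝓜̃` (Lemma 9.4.13 items 1–2: `f = 0`, `λ = 1`, `|f̲_PT| ≲ ε₀r^{−1}u^{−½−δ_dec}`): `B' = B + f̲·α`
EXACTLY, error `f̲_PT·A`: far rate `9/2 + δ_extra` (margin `3 + 2δ_extra − δ_B`), near rate `4`.
[cite: KlainermanSzeftel2021, Lemma 9.4.13 items 1–2, TeX l.24377–24399 (= KlainermanSzeftel2023 (9.4.26)–(9.4.29)); Ref 2 l.13745–13757] -/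
theorem fbPT_far_margin (δB δextra : ℝ) : margin (wAB δB) (9 / 2 + δextra) = 3 + 2 * δextra - δB := by
  rw [farMargin_eq]; ring

/-- … positive margin and `u`-exponent `< −1` in the far zone `r ≥ u`.  [cite: KlainermanSzeftel2021, Lemma 9.4.13 items 1–2 TeX l.24377–24399; Ref 2 l.13745–13757] -/
theorem fbPT_far_u {δB δdec δextra : ℝ} (hB : δB < 3) (hd : 0 ≤ δdec) (he : 0 ≤ δextra) :
    0 < margin (wAB δB) (9 / 2 + δextra) ∧ uExp 1 δB (9 / 2 + δextra) (1 / 2 + δdec) < -1 := by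
  refine ⟨by rw [fbPT_far_margin]; linarith, ?_⟩; unfold uExp; nlinarith

/-- … near zone `r ≤ u`: `|f̲_PT||A| ≲ ε₀²r^{−4}u^{−1−δ_dec−δ_extra}`, rate `4` — margin `2 − δ_B > 0`, so even the radial integral from `r₀` is bounded.  [cite: KlainermanSzeftel2021, Lemma 9.4.13 items 1–2 TeX l.24377–24399] -/
theorem fbPT_near_margin_pos {δB : ℝ} (hB : δB < 2) : 0 < margin (wAB δB) 4 := frho_far_margin_pos hB

/-- Layer `R̃` / `Σ̃_*(u ≤ u_*)`: FTC along `e₄` over affine length `≤ Δ_ext` from the old `Σ_*` (where [J] Prop 5.7.3 prints the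
rate `7/2 + δ_extra`), with `|∇₄𝔡^{≤k−1}B| ≲ ε₀r^{−4}u^{−½−δ_dec}` from (8.5.64): error `ε₀Δ_ext r^{−4}u^{−½−δ_dec}` — the `(3/2)Fρ`
far row again.  [cite: KlainermanSzeftel2021, Step 3 TeX l.21644–21652, Step 9 l.22086–22100, (8.5.64) l.22975–22980; KlainermanSzeftel2023 Prop 5.7.3 (HAL p.319) = KlainermanSzeftel2021 TeX l.12782–12790] -/
theorem layer_far {δB δdec : ℝ} (hB : δB < 2) (hd : 0 ≤ δdec) :
    0 < margin (wAB δB) 4 ∧ uExp (1 / 2) δB 4 (1 / 2 + δdec) < -1 :=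
  ⟨frho_far_margin_pos hB, frho_far_u hB hd⟩

/-- The transferred far branch itself: `ε₀r^{−7/2−δ_dec}` has margin `1 + 2δ_dec − δ_B > 0` in the bulk and on `Σ_*`
(`r^{4+δ_B}`, area `r²du`: power `6 + δ_B − 7 − 2δ_dec = −(1 + 2δ_dec − δ_B)`), versus `−δ_B` / `+δ_B` at the recorded rate `3`
(`marginAB_recorded`, `starPowerB_recorded`).  [cite: KlainermanSzeftel2023, Prop 6.5.4 (HAL p.407); KlainermanSzeftel2021 (9.4.4)/(9.4.1) TeX l.23911–23916, l.23887–23893] -/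
theorem farBranch_margin (δB δdec : ℝ) : margin (wAB δB) (7 / 2 + δdec) = 1 + 2 * δdec - δB := by
  rw [farMargin_eq]; ring

/-- … positive for `δ_B < 1` (the bulk `B`-piece with the far branch is `r_*`-free).  [cite: KlainermanSzeftel2023, Prop 6.5.4 (HAL p.407); KlainermanSzeftel2021 (9.4.4) TeX l.23911–23916] -/
theorem farBranch_margin_pos {δB δdec : ℝ} (hB : δB < 1) (hd : 0 ≤ δdec) : 0 < margin (wAB δB) (7 / 2 + δdec) := by
  rw [farBranch_margin]; linarith

/-- On `Σ_*` (`wABstar = 4 + δ_B`, area `r²du`) the far branch carries the power `r^{6+δ_B−7−2δ_dec} = r^{−(1+2δ_dec−δ_B)}`.  [cite: KlainermanSzeftel2021, (9.4.1) TeX l.23887–23893; KlainermanSzeftel2023 Prop 5.7.3 (HAL p.319)] -/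
theorem farBranch_starPower (δB δdec : ℝ) : wABstar δB + 2 - 2 * (7 / 2 + δdec) = -(1 + 2 * δdec - δB) := by
  unfold wABstar; ring

/-! ## §3 The window of the main profile (V-J654, lead block 36 (2)) re-derived -/

/-- Crossover exponent of the two [J] branches `r^{−3−δ'}u^{−½−δ_dec} = r^{−7/2−δ_dec}`: `r = u^{x_c}`,
`x_c = (½+δ_dec)/(½+δ_dec−δ')`, `δ' = (δ_extra−δ_dec)/2`.  [cite: KlainermanSzeftel2023, Prop 6.5.4 (HAL p.407); KlainermanSzeftel2021 δ' TeX l.13770] -/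
def xc (δdec δextra : ℝ) : ℝ := (1 / 2 + δdec) / (1 / 2 + δdec - deltaPrime δextra δdec)

/-- `x_c · (½ + δ_dec − δ') = ½ + δ_dec`.  [folklore] -/
theorem xc_mul {δdec δextra : ℝ} (h : 1 / 2 + δdec - deltaPrime δextra δdec ≠ 0) :
    xc δdec δextra * (1 / 2 + δdec - deltaPrime δextra δdec) = 1 / 2 + δdec := by
  unfold xc; exact div_mul_cancel₀ _ h

/-- The zone-II = zone-III `u`-exponent of V-J654: `E = x_c(δ_B − 1 − 2δ_dec)` (GAPS block 36 (2)).  [folklore] -/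
def E (δB δdec δextra : ℝ) : ℝ := xc δdec δextra * (δB - 1 - 2 * δdec)

/-- V-J654's threshold `T = 2δ_dec + (δ_extra − δ_dec)/(1+2δ_dec)`, written over the common denominator.  [folklore] -/
def T (δdec δextra : ℝ) : ℝ := (2 * δdec * (1 + 2 * δdec) + (δextra - δdec)) / (1 + 2 * δdec)

/-- `T = 2δ_dec + (δ_extra − δ_dec)/(1+2δ_dec)` (the form printed in GAPS block 36 (2)).  [folklore] -/
theorem T_eq {δdec δextra : ℝ} (hd : 1 + 2 * δdec ≠ 0) :
    T δdec δextra = 2 * δdec + (δextra - δdec) / (1 + 2 * δdec) := by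
  unfold T; rw [add_div, mul_div_assoc, div_self hd, mul_one]

/-- The zone-II exponent `x_c(δ_B − 2δ') − 1 − 2δ_dec` coincides with `E` (block 36 (2): "E_II ≡ E_III").  [folklore] -/
theorem E_II_eq_E {δB δdec δextra : ℝ} (h : 1 / 2 + δdec - deltaPrime δextra δdec ≠ 0) :
    xc δdec δextra * (δB - 2 * deltaPrime δextra δdec) - 1 - 2 * δdec = E δB δdec δextra := by
  have hk := xc_mul h
  unfold E
  linear_combination 2 * hk

/-- The cleared identity behind "E < −1 ⇔ δ_B < T":
`(E + 1)·2(½+δ_dec−δ') = (1+2δ_dec)δ_B − [2δ_dec(1+2δ_dec) + (δ_extra−δ_dec)]`.  [folklore] -/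
theorem E_add_one_mul {δB δdec δextra : ℝ} (h : 1 / 2 + δdec - deltaPrime δextra δdec ≠ 0) :
    (E δB δdec δextra + 1) * (2 * (1 / 2 + δdec - deltaPrime δextra δdec)) =
      (1 + 2 * δdec) * δB - (2 * δdec * (1 + 2 * δdec) + (δextra - δdec)) := by
  have hk := xc_mul h
  unfold E
  unfold deltaPrime at hk ⊢
  linear_combination (2 * (δB - 1 - 2 * δdec)) * hk

/-- `E < −1 ↔ δ_B < T` (for `½ + δ_dec − δ' > 0`, i.e. `δ_extra < 1 + 3δ_dec`, always the case for the small constants, and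
`1 + 2δ_dec > 0`).  [folklore] -/
theorem E_lt_neg_one_iff {δB δdec δextra : ℝ} (hpos : 0 < 1 / 2 + δdec - deltaPrime δextra δdec) (hd : 0 < 1 + 2 * δdec) :
    E δB δdec δextra < -1 ↔ δB < T δdec δextra := by
  have key := E_add_one_mul (δB := δB) hpos.ne'
  unfold T
  rw [lt_div_iff₀ hd]
  constructor
  · intro h
    have : (E δB δdec δextra + 1) * (2 * (1 / 2 + δdec - deltaPrime δextra δdec)) < 0 :=
      mul_neg_of_neg_of_pos (by linarith) (by linarith)
    nlinarith [key]
  · intro h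
    have hneg : (E δB δdec δextra + 1) * (2 * (1 / 2 + δdec - deltaPrime δextra δdec)) < 0 := by
      rw [key]; nlinarith
    have : E δB δdec δextra + 1 < 0 := by
      by_contra hc
      have hc' : 0 ≤ E δB δdec δextra + 1 := le_of_not_gt hc
      have := mul_nonneg hc' (by linarith : (0:ℝ) ≤ 2 * (1 / 2 + δdec - deltaPrime δextra δdec))
      linarith
    linarith

/-- The table value of block 36 (2): `δ_dec = 1/100`, `δ = 1/1000`, GKS `δ_extra = (3δ_dec − 2δ)/2 = 7/500`:
`T = 61/2550 = 0.0239215686…`.  [folklore] -/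
theorem T_table : T (1 / 100) (7 / 500) = 61 / 2550 := by unfold T; norm_num

/-- `T < 2δ_extra` as soon as `δ_dec < δ_extra` and `δ_dec ≥ 0`: the `B`-window binds before the `A`-window `δ_B < 2δ_extra` of
`SupToFluxExponents` / block 14 (`2δ_extra − T = (δ_extra−δ_dec)(1+4δ_dec)/(1+2δ_dec)`).  [folklore] -/
theorem T_lt_two_deltaExtra {δdec δextra : ℝ} (hd : 0 ≤ δdec) (hde : δdec < δextra) : T δdec δextra < 2 * δextra := by
  unfold T
  rw [div_lt_iff₀ (by linarith)]
  nlinarith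

/-- The window is nonempty iff `δ_dec < δ_extra` (given `δ_dec ≥ 0`).  [folklore] -/
theorem window_nonempty_iff {δdec δextra : ℝ} (hd : 0 ≤ δdec) : 2 * δdec < T δdec δextra ↔ δdec < δextra := by
  unfold T
  rw [lt_div_iff₀ (by linarith)]
  constructor <;> intro h <;> nlinarith

/-! ## §4 The `Σ̃_*`-piece with the far branch -/

/-- `ε₀`-power of `∫_{Σ_*} r^{4+δ_B}|B|²` with `|B| ≤ ε₀r^{−7/2−δ_dec}`, after `r ≍ r_* = δ_*ε₀^{−1}u_*^{1+δ_dec}`: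
`2 + (1 − δ_B + 2δ_dec)`.  [cite: KlainermanSzeftel2021, (9.4.1) TeX l.23887–23893; `eq:behaviorofronS-star` l.6103–6106] -/
def starEpsPow (δB δdec : ℝ) : ℝ := 3 - δB + 2 * δdec

/-- `u_*`-power of the same piece: `1 − (1+δ_dec)(1 − δ_B + 2δ_dec) = δ_B(1+δ_dec) − δ_dec(3+2δ_dec)`.
[cite: KlainermanSzeftel2021, (9.4.1) TeX l.23887–23893; l.6103–6106] -/
def starUPow (δB δdec : ℝ) : ℝ := 1 - (1 + δdec) * (1 - δB + 2 * δdec)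

/-- `starUPow = δ_B(1+δ_dec) − δ_dec(3+2δ_dec)`.  [folklore] -/
theorem starUPow_eq (δB δdec : ℝ) : starUPow δB δdec = δB * (1 + δdec) - δdec * (3 + 2 * δdec) := by
  unfold starUPow; ring

/-- The `ε₀`-power exceeds `2` for `δ_B < 1`: the `Σ̃_*`-piece is `o(ε₀²)` once it is `u_*`-uniform.  [folklore] -/
theorem starEpsPow_gt_two {δB δdec : ℝ} (hB : δB < 1) (hd : 0 ≤ δdec) : 2 < starEpsPow δB δdec := by
  unfold starEpsPow; linarith

/-- On the window (`δ_B < T`) with GKS's `δ_extra ≤ 3δ_dec/2` the `u_*`-power is NEGATIVE (the piece is `u_*`-uniform):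
structural margin `δ_dec(3+2δ_dec)/(1+δ_dec) − [2δ_dec + δ_dec/(2(1+2δ_dec))] = δ_dec(1+3δ_dec)/(2(1+δ_dec)(1+2δ_dec)) > 0`.
[folklore] -/
theorem starUPow_neg {δB δdec δextra : ℝ} (hd : 0 < δdec) (h32 : δextra ≤ 3 / 2 * δdec)
    (hB : δB < T δdec δextra) : starUPow δB δdec < 0 := by
  rw [starUPow_eq]
  have hK : 0 < 1 + 2 * δdec := by linarith
  have hB' : δB * (1 + 2 * δdec) < 2 * δdec * (1 + 2 * δdec) + (δextra - δdec) := by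
    unfold T at hB; exact (lt_div_iff₀ hK).mp hB
  -- δB(1+2δdec)(1+δdec) < (1+δdec)(2δdec(1+2δdec) + δdec/2) ≤ δdec(3+2δdec)(1+2δdec)  [0 ≤ 1+3δdec]
  have h5 : δB * (1 + 2 * δdec) * (1 + δdec) < (2 * δdec * (1 + 2 * δdec) + δdec / 2) * (1 + δdec) :=
    mul_lt_mul_of_pos_right (by linarith) (by linarith)
  nlinarith [h5, hK]

/-- With rate `3` only (`|B| ≲ ε₀r^{−3}u^{−½−δ_dec}`) the same piece is `≍ ε₀^{2−δ_B}u_*^{(1+δ_dec)δ_B}`: its `u_*`-power is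
POSITIVE — not uniform (`starPowerB_recorded`).  [folklore] -/
theorem starUPow_rate3_pos {δB δdec : ℝ} (hB : 0 < δB) (hd : 0 ≤ δdec) : 0 < (1 + δdec) * δB := by positivity

/-! ## §5 The top piece: the width of `ᵗᵒᵖ𝓜(r ≥ r₀)` from the printed `σ_top` -/

/-- `g'(r) · r²Δ` for `g(r) := (u̲ − u)(r) + σ_top(r)`, `σ_top = −2(r−r₀) − 4m log(r/r₀) − m²/r + c₂`, `½(u̲−u)' = (r²+a²)/Δ`:
`N(r) = 9m²r² − (4ma² + 2m³)r + m²a²`.  [cite: KlainermanSzeftel2021, §3 footnote TeX l.5377–5384; App. D l.32055–32061, l.31810–31814] -/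
def widthNumerator (m a r : ℝ) : ℝ := 9 * m ^ 2 * r ^ 2 - (4 * m * a ^ 2 + 2 * m ^ 3) * r + m ^ 2 * a ^ 2

/-- The identity `2(r²+a²)/Δ − 2 − 4m/r + m²/r² = N(r)/(r²Δ)`, `Δ = r² − 2mr + a²`.
[cite: KlainermanSzeftel2021, App. D TeX l.32089–32092 (f₁', f₂'), Lemma l.31823–31827] -/
theorem gprime_eq {m a r Δ : ℝ} (hr : r ≠ 0) (hΔ0 : Δ ≠ 0) (hΔ : Δ = r ^ 2 - 2 * m * r + a ^ 2) :
    2 * (r ^ 2 + a ^ 2) / Δ - 2 - 4 * m / r + m ^ 2 / r ^ 2 = widthNumerator m a r / (r ^ 2 * Δ) := by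
  unfold widthNumerator
  field_simp
  subst hΔ
  ring

/-- `N(r) > 0` for `r ≥ m > 0`, `a² ≤ m²` (hence on `r ≥ r₀ ≫ m` for every `|a| ≤ m`): the width `w(r) = ∫_r^{r_*} g'` is
positive and decreasing in `r`.  [folklore] -/
theorem widthNumerator_pos {m a r : ℝ} (hm : 0 < m) (ha : a ^ 2 ≤ m ^ 2) (hr : m ≤ r) : 0 < widthNumerator m a r := by
  unfold widthNumerator
  have hr0 : 0 ≤ r := le_trans hm.le hr
  have ha' : 4 * m * a ^ 2 ≤ 4 * m * m ^ 2 := mul_le_mul_of_nonneg_left ha (by positivity)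
  have h1 : (4 * m * a ^ 2 + 2 * m ^ 3) * r ≤ 6 * m ^ 3 * r :=
    mul_le_mul_of_nonneg_right (by nlinarith) hr0
  have hr' : 0 < r := lt_of_lt_of_le hm hr
  have h2 : 0 < 9 * m ^ 2 * r ^ 2 - 6 * m ^ 3 * r := by
    have : 9 * m ^ 2 * r ^ 2 - 6 * m ^ 3 * r = 3 * m ^ 2 * r * (3 * r - 2 * m) := by ring
    rw [this]
    exact mul_pos (by positivity) (by linarith)
  nlinarith [sq_nonneg a, sq_nonneg m]

/-- Leading behaviour: `N(r) ≤ 9m²r² + m²a²` and `N(r) ≥ 9m²r² − 6m³r` (for `a² ≤ m²`, `m, r ≥ 0`) — i.e. `g' = 9m²/r² + O(m³/r³)`,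
width `w(r) ≍ 9m²(1/r − 1/r_*)`.  [folklore] -/
theorem widthNumerator_bounds {m a r : ℝ} (hm : 0 ≤ m) (ha : a ^ 2 ≤ m ^ 2) (hr : 0 ≤ r) :
    9 * m ^ 2 * r ^ 2 - 6 * m ^ 3 * r ≤ widthNumerator m a r ∧ widthNumerator m a r ≤ 9 * m ^ 2 * r ^ 2 + m ^ 2 * a ^ 2 := by
  unfold widthNumerator
  constructor <;> nlinarith [sq_nonneg a, mul_nonneg hm hr]

/-- Top `B`-piece from rate `3` with the thin width `w ≲ 9m²/r`: integrand `≍ m² r^{−1} · r^{5+δ_B} · r^{−6} = m² r^{−2+δ_B}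
= m² r^{−1−(1−δ_B)}`, `r_*`-FREE: `∫_{r₀}^{R} r^{−1−(1−δ_B)} ≤ r₀^{−(1−δ_B)}/(1−δ_B)` for every `R ≥ r₀`.
[cite: KlainermanSzeftel2021, ᵗᵒᵖℜ TeX l.23988–23997; §3 footnote l.5377–5384] -/
theorem top_thin_bounded {δB r₀ R : ℝ} (hB : δB < 1) (hr₀ : 0 < r₀) (hR : r₀ ≤ R) :
    ∫ x in r₀..R, x ^ (-1 - (1 - δB)) ≤ r₀ ^ (-(1 - δB)) / (1 - δB) :=
  radial_bounded_of_margin_pos (by linarith) hr₀ hR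

/-- The exponent identity used in `top_thin_bounded`: width `r^{−1}` × weight `r^{5+δ_B}` × rate-3 square `r^{−6}` = `r^{−1−(1−δ_B)}`.  [folklore] -/
theorem top_thin_exponent (δB : ℝ) : (-1 : ℝ) + (5 + δB) - 6 = -1 - (1 - δB) := by ring

/-- … whereas an `r`-independent width (Prop 9.3.5 item 3 alone: null width `≤ 2(2m+1)`, TeX l.23785–23788) leaves the
integrand `r^{5+δ_B−6} = r^{−1+δ_B}`: exponent `> −1`, so `∫_{r₀}^{R}` grows with `R ≍ r_*` — the `ε₀^{−δ_B}` power loss of block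
9 (3)(c2)'s slice genre.  [cite: KlainermanSzeftel2021, Prop 9.3.5 item 3 TeX l.23785–23788] -/
theorem top_crude_exponent {δB : ℝ} (hB : 0 < δB) : (-1 : ℝ) < (5 + δB) - 6 := by linarith

end Literature.Geometry.Lorentzian.KlainermanSzeftel2021.FrameTransferCount
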